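import Summits.BirchSwinnertonDyer.BirchSwinnertonDyer.Theorems.AdditiveKolyvaginRoadRamifiedHabitatSignLawAnyLevelSketch
import Summits.BirchSwinnertonDyer.BirchSwinnertonDyer.Theorems.AdditiveKolyvaginRoadRamifiedHabitatSignLawIZeroStar
import HarnessLib

/-!
# Route `AdditiveKolyvaginRoad`, crux KS′ `LevelKolyvaginSystemsAdditive` (stmt-BirchSwinnertonDyer-21396), card `ramified-toric-habitat` —
# type `I₀*` (`e = 2`) for ARBITRARY reduction off `p`, PURELY MODULAR at `p`; and the complete principal-series half in the sketch's binders

Cell `pub/bsd-wall`, width seat `bsd-wall-akr-p2x-w2` g12; `--supports stmt-BirchSwinnertonDyer-21396` (helper). THEOREMS ONLY; no definition,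
no named fact, no `sorry`. BSD is not proved by any of this; KS′/KPA′ stay OPEN at `p² ∣ N`.

g11's part 8 (`…RamifiedHabitatSignLawIZeroStar`) treats Kodaira type `I₀*` at `p ≥ 5` (`ord_p Δ_min = 6`; the twist `E' = E^{(p*)}` is GOOD at `p`,
`N_{E'} = M`) for `M` SQUAREFREE, reading `λ_p(f) = W_p(E)` through the tree's theorem `atkinLehnerEigenvalueAt_eq_localRootNumberAt_of_twist`, whose
guard «no additive reduction at `2, 3`» is exactly what a general `M` violates. Here the eigenvalue at `p` is read on the MODULAR side instead:
`f = (f')_χ` with `f'` of level `M` prime to `p`, so `λ_p(f) = χ(−1) = (−1/p)` by the tree's `atkinLehnerEigenvalueAt_eq_χ₄_of_cuspCoeff_eq`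
(Atkin–Lehner 1970 §6), and at `q ∣ M` the new commutation rule `λ_q(f) = (q^{v_q}/p)·λ_q(f')` (`atkinLehnerEigenvalueAt_charTwist_of_coprime`,
Shemanske–Walling Prop. 5.4) — no local root number is evaluated anywhere, so NO restriction on `M` and NO named fact beyond Modularity:

* §15 `atkinLehnerEigenvalueAt_mul_eq_legendreSym_pow_of_cuspCoeff` — `λ_q(f)·λ_q(f') = (q^{v_q(N)}/p)` whenever `f = (f')_χ` by `q`-expansion
  (levels `N' ∣ N`, `p² ∣ N`, `v_q(N') = v_q(N)`); `rootNumber_mul_rootNumber_pStarTwist_eq_legendreSym_mul_χ₄_of_good` — `N_E = M p²`, `N_{E'} = M`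
  ⟹ `w(E)·w(E') = (M/p)·(−1/p)` from `IsNewformOf` data ALONE.
* §16 `rootNumber_mul_rootNumber_pStarTwist_of_six_anyLevel`, `rootNumber_mul_rootNumber_ramifiedTwist_of_six_anyLevel` (`= −1` in the ramified
  habitat), `signLaw_IZeroStar_of_isGloballyMinimal_anyLevel` — g11's part 8 / §11 WITHOUT `Squarefree M`, assuming ONLY `exists_isNewformOf`.
* §17 `rootNumber_mul_rootNumber_twist_discr_eq_neg_one_of_addv_of_padicValRat_j_nonneg` — THE COMPLETE PRINCIPAL-SERIES HALF in the sketch's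
  binders on EVERY potentially good additive row: `W` global minimal, `p ≥ 5`, `Addv W p`, `0 ≤ ord_p j`, `W.semistabilityDefectAt p ∣ p − 1`,
  `K′` imaginary quadratic with odd `d_{K′}`, `p ∣ d_{K′}`, `OtherBadPrimesSplit` ⟹ `w(E)·w(E^{(d_{K′})}) = −1` (type `I₀*` by §16, the six other
  types by `…SignLawAnyLevelSketch`). Together with `rootNumber_mul_rootNumber_twist_discr_eq_one_of_addv_of_not_semistabilityDefectAt_dvd` this is
  the card's sign DICHOTOMY on all additive potentially good `p ≥ 5`, odd `d_{K′}`, arbitrary reduction elsewhere; the only rows left out are the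
  potentially multiplicative ones, where the sketch's `SignLawPrincipalSeries` is false (evidence #41; g11's `…SignLawPotMult`).

CONDITIONAL on the Modularity Theorem (`exists_isNewformOf`) and — for the six types with `E'` additive, not for `I₀*` — Kellock–Dokchitser's
Rem. 2.2 at `p` (named fact `atkinLehnerEigenvalueAt_eq_localRootNumberAt`). BSD is not proved by any of this.

References: [cite: ShemanskeWalling1993, Prop. 5.4] [cite: AtkinLehner1970, §6] [cite: Knapp1993, Thm. 9.27] [cite: Rohrlich1993Compositio, Prop. 2(iv)]
[cite: KellockDokchitser2023, Rem. 2.2] [cite: Serre1972, §5.6 (p. 312)].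
-/

set_option autoImplicit false
set_option linter.dupNamespace false

noncomputable section

open scoped Classical MatrixGroups NumberTheorySymbols

open CongruenceSubgroup IsDedekindDomain IsDedekindDomain.HeightOneSpectrum NumberField Rat.HeightOneSpectrum
  WeierstrassCurve Literature.NumberTheory.EllipticCurves Literature.NumberTheory.EllipticCurves.ModularForms
  IsDiscreteValuationRing

namespace Summit.BirchSwinnertonDyer.BirchSwinnertonDyer.Theorems.AdditiveKoly.RamifiedHabitat

/-! ## §15 The modular assembly when the twist is good at `p` (`N_{E'} = M`), any `M` -/

section Modular

variable {p : ℕ} [Fact p.Prime]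

/-- **`λ_q(f)·λ_q(f') = (q^{v_q(N)}/p)` whenever `f = (f')_χ` by `q`-expansion**, `χ = (·/p)`: `f ∈ S₂(Γ₀(N))`, `f' ∈ S₂(Γ₀(N'))` newforms with
`aₙ(f) = (n/p)·aₙ(f')` for all `n`, levels `N' ∣ N`, `p² ∣ N`, and a prime `q ≠ p`, `q ∣ N'`, with `v_q(N') = v_q(N)`. By the `q`-expansion principle
`f = (f')_χ` (`cuspCoeff_charTwist`); then `λ_q(f) = χ(q^{v_q(N)})·λ_q(f')` (`atkinLehnerEigenvalueAt_charTwist_of_coprime`) and `λ_q(f')² = 1`.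
[cite: ShemanskeWalling1993, Prop. 5.4] [cite: Knapp1993, Thm. 9.27] -/
theorem atkinLehnerEigenvalueAt_mul_eq_legendreSym_pow_of_cuspCoeff (hp2 : p ≠ 2) {N N' : ℕ} [NeZero N] [NeZero N']
    (hN'N : N' ∣ N) (hpN : p ^ 2 ∣ N) {f : CuspForm (Gamma0 N) 2} {f' : CuspForm (Gamma0 N') 2} (hf : IsNewform0 f) (hf' : IsNewform0 f')
    (hcoeff : ∀ n : ℕ, cuspCoeff f n = (legendreSym p n : ℂ) * cuspCoeff f' n) {q : ℕ} (hq : q ∈ N.primeFactors) (hqp : q ≠ p)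
    (hqN' : q ∣ N') (hv : N'.factorization q = N.factorization q) :
    atkinLehnerEigenvalueAt f q * atkinLehnerEigenvalueAt f' q = legendreSym p (q ^ N.factorization q : ℕ) := by
  have hqP : q.Prime := Nat.prime_of_mem_primeFactors hq
  set χ : DirichletCharacter ℂ p := (quadraticChar (ZMod p)).ringHomComp (Int.castRingHom ℂ) with hχ
  have hquad := isQuadratic_quadraticChar_ringHomComp p
  have hprim := isPrimitive_quadraticChar_ringHomComp p hp2
  have hfeq : f = charTwist N hN'N hpN hquad f' := by
    refine eq_of_forall_cuspCoeff_eq_gamma0 fun n ↦ ?_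
    rw [cuspCoeff_charTwist _ hN'N hpN hquad hprim f' n, hcoeff n, ← hχ, quadraticChar_ringHomComp_apply_natCast]
  have hf0 : f ≠ 0 := fun h0 ↦ hf.coe_ne_zero (by rw [h0]; rfl)
  have hε' := hf'.atkinLehnerInvolutionAt_eq_atkinLehnerEigenvalueAt_smul hqP hqN'
  have hne : charTwist N hN'N hpN hquad f' ≠ 0 := hfeq ▸ hf0
  have hlam : atkinLehnerEigenvalueAt f q = χ (q ^ N.factorization q : ℕ) * atkinLehnerEigenvalueAt f' q := by
    conv_lhs => rw [hfeq]
    exact atkinLehnerEigenvalueAt_charTwist_of_coprime N hN'N hpN hq hqp hv hquad hε' hne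
  have hsq : atkinLehnerEigenvalueAt f' q * atkinLehnerEigenvalueAt f' q = 1 := by
    rcases hf'.atkinLehnerEigenvalueAt_eq_one_or_eq_neg_one hqP hqN' with h | h <;> rw [h] <;> norm_num
  rw [hlam, hχ, quadraticChar_ringHomComp_apply_natCast, mul_assoc, hsq, mul_one]

/-- **`w(E)·w(E') = (M/p)·(−1/p)` when `N_E = M p²` and `N_{E'} = M`, for EVERY `M` prime to `p`, from `IsNewformOf` data alone** (`E' = E^{(p*)}`
GOOD at `p`, e.g. type `I₀*`): `w = −ε(f) = −∏ λ_q` (Knapp Thm. 9.27(c)); `f = (f')_χ` by `q`-expansion (`E` is additive at `p` since `p² ∣ N_E`);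
AT `p`: `λ_p(f) = χ(−1) = (−1/p)` because `f'` has level `M ∣ M p` prime to `p` (`atkinLehnerEigenvalueAt_eq_χ₄_of_cuspCoeff_eq`, Atkin–Lehner 1970
§6 — the MODULAR side, no local root number); at `q ∣ M`: §15. g11's `…_of_good` is the case `M` squarefree with `λ_p(f)` left symbolic.
[cite: Knapp1993, Thm. 9.27] [cite: AtkinLehner1970, §6] [cite: ShemanskeWalling1993, Prop. 5.4] -/
theorem rootNumber_mul_rootNumber_pStarTwist_eq_legendreSym_mul_χ₄_of_good (W : WeierstrassCurve ℚ) [W.IsElliptic]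
    [NeZero (W.conductorNorm ℤ)] (hp2 : p ≠ 2) {M : ℕ} (hN : W.conductorNorm ℤ = M * p ^ 2) (hpM : ¬ p ∣ M)
    [(W.quadraticTwist (((-1 : ℤ) ^ (p / 2) * p : ℤ) : ℚ)).IsElliptic]
    [NeZero ((W.quadraticTwist (((-1 : ℤ) ^ (p / 2) * p : ℤ) : ℚ)).conductorNorm ℤ)]
    (hN' : (W.quadraticTwist (((-1 : ℤ) ^ (p / 2) * p : ℤ) : ℚ)).conductorNorm ℤ = M)
    {f : CuspForm (Gamma0 (W.conductorNorm ℤ)) 2} (hf : IsNewformOf W f)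
    {f' : CuspForm (Gamma0 ((W.quadraticTwist (((-1 : ℤ) ^ (p / 2) * p : ℤ) : ℚ)).conductorNorm ℤ)) 2}
    (hf' : IsNewformOf (W.quadraticTwist (((-1 : ℤ) ^ (p / 2) * p : ℤ) : ℚ)) f') :
    ((W.rootNumber * (W.quadraticTwist (((-1 : ℤ) ^ (p / 2) * p : ℤ) : ℚ)).rootNumber : ℤ) : ℂ) = legendreSym p M * ZMod.χ₄ p := by
  have hp : p.Prime := Fact.out
  have hw : (W.rootNumber : ℂ) = -frickeEigenvalue f :=
    Literature.NumberTheory.EllipticCurves.rootNumber_eq_neg_of_frickeInvolution_eq_smul W hf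
      (IsNewform0.frickeEigenvalue_eq_one_or_eq_neg_one_holds hf.1) (IsNewform0.frickeInvolution_eq_smul_holds hf.1)
  have hw' : ((W.quadraticTwist (((-1 : ℤ) ^ (p / 2) * p : ℤ) : ℚ)).rootNumber : ℂ) = -frickeEigenvalue f' :=
    Literature.NumberTheory.EllipticCurves.rootNumber_eq_neg_of_frickeInvolution_eq_smul _ hf'
      (IsNewform0.frickeEigenvalue_eq_one_or_eq_neg_one_holds hf'.1) (IsNewform0.frickeInvolution_eq_smul_holds hf'.1)
  have hε := IsNewform0.frickeEigenvalue_eq_prod_atkinLehnerEigenvalueAt_holds hf.1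
  have hε' := IsNewform0.frickeEigenvalue_eq_prod_atkinLehnerEigenvalueAt_holds hf'.1
  have hM0 : M ≠ 0 := fun h ↦ NeZero.ne (W.conductorNorm ℤ) (by rw [hN, h, zero_mul])
  have hpf : (W.conductorNorm ℤ).primeFactors = insert p M.primeFactors := by
    rw [hN, Nat.primeFactors_mul hM0 (pow_ne_zero 2 hp.ne_zero), Nat.primeFactors_pow _ two_ne_zero, hp.primeFactors,
      Finset.union_comm]
    rfl
  have hpf' : ((W.quadraticTwist (((-1 : ℤ) ^ (p / 2) * p : ℤ) : ℚ)).conductorNorm ℤ).primeFactors = M.primeFactors := by rw [hN']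
  have hpnot : p ∉ M.primeFactors := fun h ↦ hpM (Nat.dvd_of_mem_primeFactors h)
  -- levels
  have hN'N : (W.quadraticTwist (((-1 : ℤ) ^ (p / 2) * p : ℤ) : ℚ)).conductorNorm ℤ ∣ W.conductorNorm ℤ := by
    rw [hN', hN]; exact dvd_mul_right M _
  have hN'Mp : (W.quadraticTwist (((-1 : ℤ) ^ (p / 2) * p : ℤ) : ℚ)).conductorNorm ℤ ∣ M * p := by
    rw [hN']; exact dvd_mul_right M p
  have hpN : p ^ 2 ∣ W.conductorNorm ℤ := hN ▸ Dvd.intro_left M rfl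
  -- `W` is additive at `p` (`p² ∣ N`): `aₙ(f) = (n/p) aₙ(f')`
  set P : Nat.Primes := ⟨p, hp⟩ with hP
  have hgen : natGenerator ((primesEquiv (R := ℤ)).symm P) = p :=
    congrArg (fun r : Nat.Primes ↦ (r : ℕ)) ((primesEquiv (R := ℤ)).apply_symm_apply P)
  have h2 : 2 ≤ W.conductorExponent ((primesEquiv (R := ℤ)).symm P) := by
    rw [← factorization_conductorNorm_holds W ((primesEquiv (R := ℤ)).symm P), hgen]
    exact (hp.pow_dvd_iff_le_factorization (NeZero.ne _)).mp hpN
  have hadd : W.HasAdditiveReductionAt ((primesEquiv (R := ℤ)).symm P) := (two_le_conductorExponent_iff_holds _ W).mp h2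
  set v : HeightOneSpectrum (𝓞 ℚ) := (primesEquiv (R := 𝓞 ℚ)).symm P with hvdef
  have hvp : (primesEquiv v : ℕ) = p := by rw [hvdef, Equiv.apply_symm_apply]
  have haddO : W.HasAdditiveReductionAt v := (W.hasAdditiveReductionAt_int_iff_ringOfIntegers P).mp hadd
  have hcoeff : ∀ n : ℕ, cuspCoeff f n = (legendreSym p n : ℂ) * cuspCoeff f' n :=
    W.cuspCoeff_eq_legendreSym_mul_cuspCoeff hp2 hvp haddO hf hf'
  have hf0 : f ≠ 0 := fun h0 ↦ hf.1.coe_ne_zero (by rw [h0]; rfl)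
  -- AT `p`: modular side, `λ_p(f) = χ(−1)`
  have hlp : atkinLehnerEigenvalueAt f p = (ZMod.χ₄ p : ℂ) := atkinLehnerEigenvalueAt_eq_χ₄_of_cuspCoeff_eq hp2 hN hpM hN'Mp hf0 hcoeff
  -- at `q ∣ M`: §15
  have hq : ∀ q ∈ M.primeFactors, atkinLehnerEigenvalueAt f q * atkinLehnerEigenvalueAt f' q =
      legendreSym p (q ^ (W.conductorNorm ℤ).factorization q : ℕ) := by
    intro q hqM
    have hqP : q.Prime := Nat.prime_of_mem_primeFactors hqM
    have hqdM : q ∣ M := Nat.dvd_of_mem_primeFactors hqM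
    have hqp : q ≠ p := fun h ↦ hpnot (h ▸ hqM)
    have hqN : q ∈ (W.conductorNorm ℤ).primeFactors := hpf ▸ Finset.mem_insert_of_mem hqM
    have hqN' : q ∣ (W.quadraticTwist (((-1 : ℤ) ^ (p / 2) * p : ℤ) : ℚ)).conductorNorm ℤ := hN' ▸ hqdM
    have hv : ((W.quadraticTwist (((-1 : ℤ) ^ (p / 2) * p : ℤ) : ℚ)).conductorNorm ℤ).factorization q =
        (W.conductorNorm ℤ).factorization q := by
      rw [hN', hN, Nat.factorization_mul hM0 (pow_ne_zero 2 hp.ne_zero), Finsupp.add_apply, hp.factorization_pow,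
        Finsupp.single_apply, if_neg (Ne.symm hqp), add_zero]
    exact atkinLehnerEigenvalueAt_mul_eq_legendreSym_pow_of_cuspCoeff hp2 hN'N hpN hf.1 hf'.1 hcoeff hqN hqp hqN' hv
  -- `∏_{q ∣ M} (q^{v_q(N)}/p) = (M/p)`
  have hfac : ∀ q ∈ M.primeFactors, (W.conductorNorm ℤ).factorization q = M.factorization q := by
    intro q hqM
    have hqp : q ≠ p := fun h ↦ hpnot (h ▸ hqM)
    rw [hN, Nat.factorization_mul hM0 (pow_ne_zero 2 hp.ne_zero), Finsupp.add_apply, hp.factorization_pow,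
      Finsupp.single_apply, if_neg (Ne.symm hqp), add_zero]
  have hleg : ∏ q ∈ M.primeFactors, (legendreSym p (q ^ (W.conductorNorm ℤ).factorization q : ℕ) : ℂ) = legendreSym p M := by
    conv_rhs => rw [Nat.prod_primeFactors_pow_factorization hM0]
    rw [Nat.cast_prod, ← legendreSym.hom_apply, map_prod]
    push_cast
    refine Finset.prod_congr rfl fun q hqM ↦ ?_
    rw [legendreSym.hom_apply, hfac q hqM]
  -- assemble
  rw [Int.cast_mul, hw, hw', hε, hε', hpf, hpf', Finset.prod_insert hpnot, neg_mul_neg, hlp, mul_assoc, ← Finset.prod_mul_distrib,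
    Finset.prod_congr rfl hq, hleg]
  ring

end Modular

/-! ## §16 Type `I₀*`, any `M`: `w(E)·w(E^{(p*)}) = (M/p)·(−1/p)` and the habitat sign `−1`, assuming ONLY the Modularity Theorem -/

section IZeroStar

variable {p : ℕ} [Fact p.Prime]

/-- **TYPE I₀*, ANY `M`: `w(E)·w(E^{(p*)}) = (M/p)·(−1/p)`, UNCONDITIONAL modulo the Modularity Theorem.** `E/ℚ` of conductor `N = M p²` (`p ≥ 5`,
`p ∤ M`, NO further hypothesis on `M`) whose minimal model at `p` has `ord_p Δ = 6`, `ord_p c₄ > 0`, `3 ord_p c₄ ≥ ord_p Δ` (type I₀*, `e = 2`): then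
`E^{(p*)}` is GOOD at `p` (g11's `hasGoodReduction_pStarTwist_padic_of_six`), `N_{E^{(p*)}} = M` (`conductorNorm_pStarTwist_mul_sq_eq_of_good`), and
§15 applies. [cite: Rohrlich1993Compositio, Prop. 2(iv)] [cite: AtkinLehner1970, §6] [cite: Knapp1993, Thm. 9.27] -/
theorem rootNumber_mul_rootNumber_pStarTwist_of_six_anyLevel (W : WeierstrassCurve ℚ) [W.IsElliptic] (hmod : exists_isNewformOf)
    (hp5 : 5 ≤ p) {M : ℕ} (hN : W.conductorNorm ℤ = M * p ^ 2) (hpM : ¬ p ∣ M)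
    (hΔ : addVal ℤ_[p] (((W.baseChange ℚ_[p]).minimal ℤ_[p]).integralModel ℤ_[p]).Δ = (6 : ℕ))
    (hc₄ : addVal ℤ_[p] (((W.baseChange ℚ_[p]).minimal ℤ_[p]).integralModel ℤ_[p]).c₄ ≠ 0)
    (hj : ¬ 3 * addVal ℤ_[p] (((W.baseChange ℚ_[p]).minimal ℤ_[p]).integralModel ℤ_[p]).c₄ <
      addVal ℤ_[p] (((W.baseChange ℚ_[p]).minimal ℤ_[p]).integralModel ℤ_[p]).Δ) :
    W.rootNumber * (W.quadraticTwist (((-1 : ℤ) ^ (p / 2) * p : ℤ) : ℚ)).rootNumber = legendreSym p M * ZMod.χ₄ p := by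
  have hp : p.Prime := Fact.out
  have hp2 : p ≠ 2 := by omega
  have hdZ0 : ((-1 : ℤ) ^ (p / 2) * p : ℤ) ≠ 0 :=
    mul_ne_zero (pow_ne_zero _ (by norm_num)) (by exact_mod_cast hp.ne_zero)
  have hd0 : (((((-1 : ℤ) ^ (p / 2) * p : ℤ)) : ℚ)) ≠ 0 := by exact_mod_cast hdZ0
  haveI hE' : (W.quadraticTwist (((-1 : ℤ) ^ (p / 2) * p : ℤ) : ℚ)).IsElliptic := W.isElliptic_quadraticTwist hd0
  haveI : NeZero (W.conductorNorm ℤ) := ⟨(W.conductorNorm_pos_holds).ne'⟩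
  haveI : NeZero ((W.quadraticTwist (((-1 : ℤ) ^ (p / 2) * p : ℤ) : ℚ)).conductorNorm ℤ) :=
    ⟨((W.quadraticTwist _).conductorNorm_pos_holds).ne'⟩
  obtain ⟨-, hgood, -⟩ := hasGoodReduction_pStarTwist_padic_of_six W hp5 hΔ hc₄ hj
  have hN' := conductorNorm_pStarTwist_mul_sq_eq_of_good W hp5 hN hpM hgood
  obtain ⟨f, hf⟩ := hmod W
  obtain ⟨f', hf'⟩ := hmod (W.quadraticTwist (((-1 : ℤ) ^ (p / 2) * p : ℤ) : ℚ))
  have h0 := rootNumber_mul_rootNumber_pStarTwist_eq_legendreSym_mul_χ₄_of_good W hp2 hN hpM hN' hf hf'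
  exact_mod_cast h0

/-- **TYPE I₀* IN THE RAMIFIED HABITAT, ANY `M`: `w(E)·w(E^{(d)}) = −1`, unconditional modulo Modularity.** `E` as in
`rootNumber_mul_rootNumber_pStarTwist_of_six_anyLevel`; `d = p*·d'` with `d' ≡ 1 (4)` squarefree prime to `N`, `d < 0`, every prime of `M` split in
`ℚ(√d)`. (`e = 2 ∣ p − 1`: principal series.) [cite: MurtyMurty1997, Ch. 6 §1] [cite: Rohrlich1993Compositio, Prop. 2(iv)] -/
theorem rootNumber_mul_rootNumber_ramifiedTwist_of_six_anyLevel (W : WeierstrassCurve ℚ) [W.IsElliptic] (hmod : exists_isNewformOf)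
    (hp5 : 5 ≤ p) {M : ℕ} (hN : W.conductorNorm ℤ = M * p ^ 2) (hpM : ¬ p ∣ M)
    (hΔ : addVal ℤ_[p] (((W.baseChange ℚ_[p]).minimal ℤ_[p]).integralModel ℤ_[p]).Δ = (6 : ℕ))
    (hc₄ : addVal ℤ_[p] (((W.baseChange ℚ_[p]).minimal ℤ_[p]).integralModel ℤ_[p]).c₄ ≠ 0)
    (hj : ¬ 3 * addVal ℤ_[p] (((W.baseChange ℚ_[p]).minimal ℤ_[p]).integralModel ℤ_[p]).c₄ <
      addVal ℤ_[p] (((W.baseChange ℚ_[p]).minimal ℤ_[p]).integralModel ℤ_[p]).Δ)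
    {d' : ℤ} (hd'4 : d' % 4 = 1) (hd'sq : Squarefree d') (hgcd : Int.gcd d' (W.conductorNorm ℤ) = 1)
    (hneg : (-1 : ℤ) ^ (p / 2) * p * d' < 0)
    (hodd : ∀ q ∈ M.primeFactors, q ≠ 2 → J((-1 : ℤ) ^ (p / 2) * p * d' | q) = 1)
    (htwo : 2 ∣ M → ((-1 : ℤ) ^ (p / 2) * p * d') % 8 = 1) :
    W.rootNumber * (W.quadraticTwist (((-1 : ℤ) ^ (p / 2) * p * d' : ℤ) : ℚ)).rootNumber = -1 := by
  have hp : p.Prime := Fact.out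
  have hp2 : p ≠ 2 := by omega
  have hdZ0 : ((-1 : ℤ) ^ (p / 2) * p : ℤ) ≠ 0 :=
    mul_ne_zero (pow_ne_zero _ (by norm_num)) (by exact_mod_cast hp.ne_zero)
  have hd0 : (((((-1 : ℤ) ^ (p / 2) * p : ℤ)) : ℚ)) ≠ 0 := by exact_mod_cast hdZ0
  haveI hE' : (W.quadraticTwist (((-1 : ℤ) ^ (p / 2) * p : ℤ) : ℚ)).IsElliptic := W.isElliptic_quadraticTwist hd0
  have hM0 : M ≠ 0 := by
    intro h; rw [h, zero_mul] at hN; exact (W.conductorNorm_pos_holds).ne' hN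
  have hA := rootNumber_mul_rootNumber_pStarTwist_of_six_anyLevel W hmod hp5 hN hpM hΔ hc₄ hj
  obtain ⟨-, hgood, -⟩ := hasGoodReduction_pStarTwist_padic_of_six W hp5 hΔ hc₄ hj
  have hN' := conductorNorm_pStarTwist_mul_sq_eq_of_good W hp5 hN hpM hgood
  have hgcd' : Int.gcd d' ((W.quadraticTwist (((-1 : ℤ) ^ (p / 2) * p : ℤ) : ℚ)).conductorNorm ℤ) = 1 := by
    rw [hN']
    have h1 := Int.isCoprime_iff_gcd_eq_one.mpr hgcd
    rw [hN] at h1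
    push_cast at h1
    exact Int.isCoprime_iff_gcd_eq_one.mp h1.of_mul_right_left
  have hB := ((W.quadraticTwist (((-1 : ℤ) ^ (p / 2) * p : ℤ) : ℚ)).rootNumber_quadraticTwist_of_emod_four_eq_one
    hmod hd'4 hd'sq hgcd').1
  rw [quadraticTwist_quadraticTwist, hN'] at hB
  have hcast : ((((-1 : ℤ) ^ (p / 2) * p : ℤ) : ℚ)) * (d' : ℚ) = (((-1 : ℤ) ^ (p / 2) * p * d' : ℤ) : ℚ) := by push_cast; ring
  rw [hcast] at hB
  have hNe0 : NeZero d'.natAbs := ⟨Int.natAbs_ne_zero.mpr (by rintro rfl; norm_num at hd'4)⟩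
  have hJM : J((M : ℤ) | d'.natAbs) = legendreSym p M := jacobiSym_natAbs_eq_legendreSym_of_split_anyLevel hp2 hd'4 hM0 hodd htwo
  have hJ1 := jacobiSym_neg_one_natAbs_eq_of_neg hp2 hd'4 hneg
  have hM2 : legendreSym p M * legendreSym p M = 1 := by
    rw [← sq]
    refine legendreSym.sq_one p ?_
    rw [Int.cast_natCast, ne_eq, ZMod.natCast_eq_zero_iff]
    exact hpM
  have hχ₄ := χ₄_mul_self_of_ne_two (p := p) hp2
  calc W.rootNumber * (W.quadraticTwist (((-1 : ℤ) ^ (p / 2) * p * d' : ℤ) : ℚ)).rootNumber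
      = J(-1 | d'.natAbs) * J((M : ℤ) | d'.natAbs) *
          (W.rootNumber * (W.quadraticTwist (((-1 : ℤ) ^ (p / 2) * p : ℤ) : ℚ)).rootNumber) := by rw [hB]; ring
    _ = -ZMod.χ₄ p * legendreSym p M * (legendreSym p M * ZMod.χ₄ p) := by rw [hJ1, hJM, hA]
    _ = -1 := by linear_combination (-(ZMod.χ₄ p * ZMod.χ₄ p)) * hM2 - hχ₄

/-- **TYPE I₀* on a global minimal model, ANY `M`: `w(E)·w(E^{(d_{K′})}) = −1`, assuming only the Modularity Theorem** (`ord_p Δ_min = 6`,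
`p ∣ c₄(W_ℤ)`, `c₄ = 0` or `6 ≤ 3 ord_p c₄`; `K′` imaginary quadratic with odd `d_{K′}`, `p ∣ d_{K′}`, every prime of `M` split) — g11's
`signLaw_IZeroStar_of_isGloballyMinimal` WITHOUT `Squarefree M`. BSD is not proved by this. [cite: Rohrlich1993Compositio, Prop. 2(iv)] [cite: AtkinLehner1970, §6] -/
theorem signLaw_IZeroStar_of_isGloballyMinimal_anyLevel (W : WeierstrassCurve ℚ) [W.IsElliptic] [W.IsGloballyMinimal]
    (hmod : exists_isNewformOf) (hp5 : 5 ≤ p) {M : ℕ} (hN : W.conductorNorm ℤ = M * p ^ 2) (hpM : ¬ p ∣ M)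
    (hΔ : padicValInt p W.minimalDiscriminantInt = 6) (hpc₄ : (p : ℤ) ∣ W.integralModelInt.c₄)
    (hj : W.integralModelInt.c₄ = 0 ∨ padicValInt p W.minimalDiscriminantInt ≤ 3 * padicValInt p W.integralModelInt.c₄)
    (K : Type) [Field K] [NumberField K] (hK : IsImaginaryQuadratic K) (hKodd : Odd (NumberField.discr K))
    (hpd : (p : ℤ) ∣ NumberField.discr K)
    (hodd : ∀ q ∈ M.primeFactors, q ≠ 2 → J(NumberField.discr K | q) = 1)
    (htwo : 2 ∣ M → NumberField.discr K % 8 = 1) :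
    W.rootNumber * (W.quadraticTwist (NumberField.discr K : ℚ)).rootNumber = -1 := by
  have hM0 : M ≠ 0 := by
    intro h; rw [h, zero_mul] at hN; exact (W.conductorNorm_pos_holds).ne' hN
  obtain ⟨hΔ', hc₄', hj'⟩ := localHypotheses_of_isGloballyMinimal (p := p) W hpc₄ hj
  rw [hΔ] at hΔ'
  obtain ⟨d', hd, hd'4, hd'sq, hgcd, hneg⟩ := ramifiedHabitat_data_of_discr_anyLevel (by omega) hM0 K hK hKodd hpd hodd htwo
  rw [hd] at hodd htwo ⊢
  rw [← hN] at hgcd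
  exact rootNumber_mul_rootNumber_ramifiedTwist_of_six_anyLevel W hmod hp5 hN hpM hΔ' hc₄' hj' hd'4 hd'sq hgcd hneg hodd htwo

end IZeroStar

/-! ## §17 The complete principal-series half in the sketch's binders (every potentially good additive row) -/

section Sketch

open Literature.NumberTheory.EllipticCurves.Rank1Residual Summit.BirchSwinnertonDyer.Rank1Residual
  Summit.BirchSwinnertonDyer.Rank1Residual.Additive

variable {p : ℕ} [hp : Fact p.Prime]

/-- **THE PRINCIPAL-SERIES HALF IN THE SKETCH'S BINDERS ON EVERY POTENTIALLY GOOD ADDITIVE ROW.** `W/ℚ` a global minimal model, `p ≥ 5` additive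
(`Addv W p`), POTENTIALLY GOOD (`0 ≤ ord_p j` — the binder the sketch's `SignLawPrincipalSeries` lacks: on the potentially multiplicative rows the law
is false, evidence #41), `W.semistabilityDefectAt p ∣ p − 1` (abelian inertia: types `I₀*` and the six types with `e ∣ p − 1`), `K′` imaginary
quadratic with odd `d_{K′}`, `p ∣ d_{K′}`, every other bad prime split (`OtherBadPrimesSplit W p d_{K′}` spelled out). Then `w(E)·w(E^{(d_{K′})}) = −1`:
the rank-one rows of such a frame never have the definite habitat. Type `I₀*` (`ord_p Δ_min = 6`) by §16 (Modularity only), the others by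
`rootNumber_mul_rootNumber_twist_discr_eq_neg_one_of_addv_of_semistabilityDefectAt_dvd` (`…SignLawAnyLevelSketch`). CONDITIONAL on {hmod, F1 at `p`};
BSD is not proved by this. [cite: Serre1972, §5.6 (p. 312)] [cite: Rohrlich1993Compositio, Prop. 2(iv)] [cite: KellockDokchitser2023, Rem. 2.2] -/
theorem rootNumber_mul_rootNumber_twist_discr_eq_neg_one_of_addv_of_padicValRat_j_nonneg
    (W : WeierstrassCurve ℚ) [W.IsElliptic] [W.IsGloballyMinimal]
    (hmod : exists_isNewformOf) (hF1 : W.atkinLehnerEigenvalueAt_eq_localRootNumberAt)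
    (hF1' : (W.quadraticTwist (((-1 : ℤ) ^ (p / 2) * p : ℤ) : ℚ)).atkinLehnerEigenvalueAt_eq_localRootNumberAt)
    (hp5 : 5 ≤ p) (hadd : Addv W p) (hj0 : 0 ≤ padicValRat p W.j) (hps : W.semistabilityDefectAt p ∣ p - 1)
    (K : Type) [Field K] [NumberField K] (hK : IsImaginaryQuadratic K) (hKodd : Odd (NumberField.discr K))
    (hpd : (p : ℤ) ∣ NumberField.discr K)
    (hsplit : ∀ q : ℕ, q.Prime → (q : ℤ) ∣ (W.conductorNorm ℤ : ℤ) → q ≠ p →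
      (q ≠ 2 → jacobiSym (NumberField.discr K) q = 1) ∧ (q = 2 → NumberField.discr K % 8 = 1)) :
    W.rootNumber * (W.quadraticTwist (NumberField.discr K : ℚ)).rootNumber = -1 := by
  by_cases h6 : padicValInt p W.minimalDiscriminantInt = 6
  · -- type I₀*
    obtain ⟨hN, hpM⟩ := conductorNorm_eq_div_mul_sq_of_addv W hp5 hadd
    set M : ℕ := W.conductorNorm ℤ / p ^ 2 with hM
    have hqN : ∀ q ∈ M.primeFactors, (q : ℤ) ∣ (W.conductorNorm ℤ : ℤ) ∧ q ≠ p := fun q hq ↦ by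
      refine ⟨?_, ?_⟩
      · rw [hN]; push_cast
        exact Dvd.dvd.mul_right (by exact_mod_cast Nat.dvd_of_mem_primeFactors hq) _
      · rintro rfl; exact hpM (Nat.dvd_of_mem_primeFactors hq)
    have hodd : ∀ q ∈ M.primeFactors, q ≠ 2 → J(NumberField.discr K | q) = 1 := fun q hq hq2 ↦
      (hsplit q (Nat.prime_of_mem_primeFactors hq) (hqN q hq).1 (hqN q hq).2).1 hq2
    have htwo : 2 ∣ M → NumberField.discr K % 8 = 1 := fun h2 ↦ by
      have h2M : 2 ∈ M.primeFactors := Nat.mem_primeFactors.mpr ⟨Nat.prime_two, h2, fun h ↦ by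
        rw [h, zero_mul] at hN; exact (W.conductorNorm_pos_holds).ne' hN⟩
      exact (hsplit 2 Nat.prime_two (hqN 2 h2M).1 (hqN 2 h2M).2).2 rfl
    exact signLaw_IZeroStar_of_isGloballyMinimal_anyLevel W hmod hp5 hN hpM h6 (dvd_c₄_integralModelInt_of_addv W hadd)
      (c₄_eq_zero_or_le_of_padicValRat_j_nonneg W hj0) K hK hKodd hpd hodd htwo
  · exact rootNumber_mul_rootNumber_twist_discr_eq_neg_one_of_addv_of_semistabilityDefectAt_dvd W hmod hF1 hF1' hp5 hadd hj0 h6 hps K hK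
      hKodd hpd hsplit

end Sketch

end Summit.BirchSwinnertonDyer.BirchSwinnertonDyer.Theorems.AdditiveKoly.RamifiedHabitat

end
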